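import Summits.KontsevichZagierPeriods.KontsevichZagierPeriods.Theses.SymplecticScissors
import Summits.KontsevichZagierPeriods.KontsevichZagierPeriods.Theorems.GammaHodgeSector.Negative.Algebraicity
import Literature.NumberTheory.Transcendental.SemialgebraicMonotonicityProofs
import Literature.NumberTheory.Transcendental.SemialgebraicDerivativeProofs
import Literature.ModelTheory.ExponentialFields.SemialgebraicC1TriangulationProofs

/-!
# `CurvePeriodsTransfer` (stmt-KontsevichZagierPeriods-11129), line `standard-etale-models`:
# stub `stub_saPieceFacts` — structure of one-variable `ℚ`-semialgebraic data

(1) A `ℚ`-semialgebraic subset of `ℝ¹` has finitely many algebraic boundary points (real roots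
of the rational polynomial of `exists_clopen_off_zeros`; connectedness of `[x, y]`).
(2) A function `f` with `ℚ`-semialgebraic graph over `(a, b)` has a finite set of algebraic break
points off which, on each cell, it is real-analytic, an ÉTALE root branch of one rational plane
curve, with algebraic values at algebraic points: a non-zero `P₀ ∈ ℚ[x, y]` vanishes on the graph
(empty interior); by induction on `deg_y`, off the real roots of the last non-zero `y`-derivative
every graph point is an étale point of some `∂_yʲ P₀`; the sets where a given `j` works and the
continuity set are `ℚ`-semialgebraic subsets of the line (Tarski–Seidenberg), so (1) makes them
constant on the cells of a finite algebraic set, discontinuities being finite by the monotonicity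
theorem; analyticity is the analytic implicit function theorem plus continuity; `f x ∈ ℚ̄`.

References: J. Bochnak, M. Coste, M.-F. Roy, *Real Algebraic Geometry* (1998), Prop. 2.9.10, §8.1;
L. van den Dries, *Tame Topology and O-minimal Structures* (1998), Ch. 3 (1.2).
-/

noncomputable section

open scoped Topology Polynomial.Bivariate ContDiff IntermediateField
open Set Filter Polynomial
open Literature.NumberTheory.Transcendental
open Literature.NumberTheory.Transcendental.SemialgebraicDerivative
open Literature.ModelTheory.ExponentialFields
open Summit.KontsevichZagierPeriods.GammaHodgeSectorNegative (exists_clopen_off_zeros)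

namespace Summit.KontsevichZagierPeriods.SymplecticScissors.CurvePeriodsTransfer

/-! ## (1) Dimension one: finitely many algebraic boundary points -/

/-- **A `ℚ`-semialgebraic subset of `ℝ¹` has finitely many algebraic boundary points**: membership
is constant on every interval `[x, y]` avoiding the real roots of the rational polynomial of
`exists_clopen_off_zeros` (the two traces on `[x, y]` are open, disjoint and cover the connected
`[x, y]`). [cite: BochnakCosteRoy1998, Prop. 2.1.7 and §2.4] -/
theorem exists_finset_mem_iff_mem (σ : Set (Fin 1 → ℝ)) (hσ : IsSemialgebraic ℚ σ) :
    ∃ E : Finset ℝ, (∀ e ∈ E, IsAlgebraic ℚ e) ∧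
      ∀ x y : ℝ, x < y → (∀ e ∈ E, e ∉ Icc x y) → ((fun _ => x) ∈ σ ↔ (fun _ => y) ∈ σ) := by
  classical
  obtain ⟨q, hq0, hU, hV⟩ := exists_clopen_off_zeros hσ
  refine ⟨(q.aroots ℝ).toFinset, fun e he => ?_, fun x y _ hE => ?_⟩
  · exact ⟨q, hq0, (mem_aroots.1 (Multiset.mem_toFinset.1 he)).2⟩
  · have hγ : Continuous fun t : ℝ => (fun _ : Fin 1 => t) := continuous_pi fun _ => continuous_id
    have hne : ∀ t ∈ Icc x y, aeval t q ≠ 0 := fun t ht h0 =>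
      hE t (Multiset.mem_toFinset.2 (mem_aroots.2 ⟨hq0, h0⟩)) ht
    have hcov : Icc x y ⊆ (fun t : ℝ => (fun _ : Fin 1 => t)) ⁻¹' (σ ∩ {w | aeval (w 0) q ≠ 0}) ∪
        (fun t : ℝ => (fun _ : Fin 1 => t)) ⁻¹' (σᶜ ∩ {w | aeval (w 0) q ≠ 0}) := fun t ht =>
      (em ((fun _ : Fin 1 => t) ∈ σ)).imp (fun h => ⟨h, hne t ht⟩) fun h => ⟨h, hne t ht⟩
    have hdisj : Disjoint ((fun t : ℝ => (fun _ : Fin 1 => t)) ⁻¹' (σ ∩ {w | aeval (w 0) q ≠ 0}))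
        ((fun t : ℝ => (fun _ : Fin 1 => t)) ⁻¹' (σᶜ ∩ {w | aeval (w 0) q ≠ 0})) :=
      disjoint_left.2 fun t h1 h2 => h2.1 h1.1
    rcases isPreconnected_Icc.subset_or_subset (hU.preimage hγ) (hV.preimage hγ) hdisj hcov
      with h | h
    · exact iff_of_true (h (left_mem_Icc.2 ‹x < y›.le)).1 (h (right_mem_Icc.2 ‹x < y›.le)).1
    · exact iff_of_false (h (left_mem_Icc.2 ‹x < y›.le)).1 (h (right_mem_Icc.2 ‹x < y›.le)).1

/-- From (1) to cells: if membership in `A` is constant on intervals avoiding `E`, then it is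
constant on every subinterval `(u, v)` of `(a, b)` avoiding the points of `E` inside `(a, b)`.
[folklore] -/
theorem mem_of_mem_of_cell {A : Set ℝ} {E : Finset ℝ} {a b u v : ℝ}
    (hE : ∀ x y : ℝ, x < y → (∀ e ∈ E, e ∉ Icc x y) → (x ∈ A ↔ y ∈ A))
    (hsub : Ioo u v ⊆ Ioo a b) (hav : ∀ e ∈ E, e ∈ Ioo a b → e ∉ Ioo u v)
    {p p' : ℝ} (hp : p ∈ Ioo u v) (hp' : p' ∈ Ioo u v) (hpA : p ∈ A) : p' ∈ A := by
  have key : ∀ s t : ℝ, s ∈ Ioo u v → t ∈ Ioo u v → s < t → ∀ e ∈ E, e ∉ Icc s t :=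
    fun s t hs ht _ e he heI =>
      have heuv : e ∈ Ioo u v := ⟨hs.1.trans_le heI.1, heI.2.trans_lt ht.2⟩
      hav e he (hsub heuv) heuv
  rcases lt_trichotomy p p' with h | rfl | h
  · exact (hE p p' h (key p p' hp hp' h)).1 hpA
  · exact hpA
  · exact (hE p' p h (key p' p hp' hp h)).2 hpA

/-! ## Definable subsets of the line attached to `f` -/

section Graph

variable {f : ℝ → ℝ} {a b : ℝ}

/-- `![w 0, w 1] = w` on `ℝ²`. [folklore] -/
theorem vec2_eq (w : Fin 2 → ℝ) : ![w 0, w 1] = w := by ext i; fin_cases i <;> rfl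

/-- The set of `x ∈ (a, b)` where `(x, f x)` is an étale point of `p` relative to `r`
(`p(x, f x) = 0`, `r(x, f x) ≠ 0`) is `ℚ`-semialgebraic (projection of a slice of the graph;
Tarski–Seidenberg). [cite: BasuPollackRoy2006, Thm. 2.76] -/
theorem sa_etaleSet (hG : IsSemialgebraic ℚ {w : Fin 2 → ℝ | w 0 ∈ Ioo a b ∧ w 1 = f (w 0)})
    (p r : MvPolynomial (Fin 2) ℚ) :
    IsSemialgebraic ℚ {z : Fin 1 → ℝ | z 0 ∈ Ioo a b ∧ MvPolynomial.aeval ![z 0, f (z 0)] p = 0 ∧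
      MvPolynomial.aeval ![z 0, f (z 0)] r ≠ 0} := by
  have key : IsSemialgebraic ℚ {z : Fin 1 → ℝ | ∃ t : ℝ, (z 0 ∈ Ioo a b ∧ t = f (z 0)) ∧
      MvPolynomial.aeval ![z 0, t] p = 0 ∧ MvPolynomial.aeval ![z 0, t] r ≠ 0} := by
    refine sa_exists (sa_and (sa_graph₀ hG _ _) (sa_and ?_ ?_))
    · convert isSemialgebraic_setOf_eval_eq_zero (R := ℝ) p using 2 with w
      simp [Fin.init, vec2_eq]
    · convert isSemialgebraic_setOf_eval_ne_zero (R := ℝ) r using 2 with w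
      simp [Fin.init, vec2_eq]
  convert key using 1
  refine Set.ext fun z => ⟨fun ⟨h1, h2, h3⟩ => ⟨f (z 0), ⟨h1, rfl⟩, h2, h3⟩, ?_⟩
  rintro ⟨t, ⟨h1, rfl⟩, h2, h3⟩
  exact ⟨h1, h2, h3⟩

/-- **The set of continuity points of `f` in `(a, b)` is `ℚ`-semialgebraic**: it is defined by the
formula `∀ ε > 0 ∃ δ > 0 ∀ s u v, (s, u) ∈ Γ → (x, v) ∈ Γ → (s − x)² < δ² → (u − v)² < ε²` over
the `ℚ`-semialgebraic graph `Γ` (Tarski–Seidenberg with rational coefficients).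
[cite: BasuPollackRoy2006, §3.5 Prop. 3.22 (with Thm. 2.76)] -/
theorem sa_continuousAt (hG : IsSemialgebraic ℚ {w : Fin 2 → ℝ | w 0 ∈ Ioo a b ∧ w 1 = f (w 0)}) :
    IsSemialgebraic ℚ {z : Fin 1 → ℝ | z 0 ∈ Ioo a b ∧ ContinuousAt f (z 0)} := by
  suffices key : IsSemialgebraic ℚ {z : Fin 1 → ℝ |
      (∃ u : ℝ, z 0 ∈ Ioo a b ∧ u = f (z 0)) ∧
      ∀ ε : ℝ, 0 < ε → ∃ δ : ℝ, 0 < δ ∧ ∀ s u v : ℝ,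
        (s ∈ Ioo a b ∧ u = f s) → (z 0 ∈ Ioo a b ∧ v = f (z 0)) →
        (s - z 0) ^ 2 < δ ^ 2 → (u - v) ^ 2 < ε ^ 2} by
    convert key using 1
    refine Set.ext fun z => ?_
    simp only [mem_setOf_eq]
    constructor
    · rintro ⟨hx, hc⟩
      refine ⟨⟨f (z 0), hx, rfl⟩, fun ε hε => ?_⟩
      obtain ⟨δ, hδ, h⟩ := Metric.continuousAt_iff.1 hc ε hε
      refine ⟨δ, hδ, fun s u v hu hv hs => ?_⟩
      rw [hu.2, hv.2, sq_lt_sq, abs_of_pos hε, ← Real.dist_eq]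
      exact h (by rwa [sq_lt_sq, abs_of_pos hδ, ← Real.dist_eq] at hs)
    · rintro ⟨⟨-, hx, -⟩, h⟩
      refine ⟨hx, Metric.continuousAt_iff.2 fun ε hε => ?_⟩
      obtain ⟨δ, hδ, h⟩ := h ε hε
      refine ⟨min δ (min (z 0 - a) (b - z 0)), lt_min hδ (lt_min (sub_pos.2 hx.1) (sub_pos.2 hx.2)),
        fun s hs => ?_⟩
      have hs' : |s - z 0| < min δ (min (z 0 - a) (b - z 0)) := by rwa [← Real.dist_eq]
      have h1 : |s - z 0| < δ := hs'.trans_le (min_le_left _ _)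
      have h2 : |s - z 0| < z 0 - a := (hs'.trans_le (min_le_right _ _)).trans_le (min_le_left _ _)
      have h3 : |s - z 0| < b - z 0 := (hs'.trans_le (min_le_right _ _)).trans_le (min_le_right _ _)
      have hsab : s ∈ Ioo a b := ⟨by linarith [(abs_lt.1 h2).1], by linarith [(abs_lt.1 h3).2]⟩
      have := h s (f s) (f (z 0)) ⟨hsab, rfl⟩ ⟨hx, rfl⟩ (by rwa [sq_lt_sq, abs_of_pos hδ])
      rwa [sq_lt_sq, abs_of_pos hε, ← Real.dist_eq] at this
  refine sa_and (sa_exists (sa_graph₀ hG _ _)) ?_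
  refine sa_forall (sa_imp (sa_pos _) (sa_exists (sa_and (sa_pos _) ?_)))
  refine sa_forall (sa_forall (sa_forall ?_))
  exact sa_imp (sa_graph₀ hG _ _) (sa_imp (sa_graph₀ hG _ _)
    (sa_imp (sa_sq_sub_lt_sq _ _ _) (sa_sq_sub_lt_sq _ _ _)))

/-- **Finitely many discontinuities** (monotonicity theorem, van den Dries Ch. 3 (1.2), in the form
`SemialgebraicMonotonicity.exists_finset_piecewise`): off a finite set, `f` is continuous at every
point of `(a, b)`. [cite: Dries1998, Ch. 3 (1.2)] -/
theorem exists_finset_continuousAt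
    (hf : IsSemialgebraicFunOn ℚ {t : Fin 1 → ℝ | t 0 ∈ Ioo a b} (fun t => f (t 0))) :
    ∃ s : Finset ℝ, ∀ x ∈ Ioo a b, x ∉ s → ContinuousAt f x := by
  obtain ⟨s, -, hs⟩ := SemialgebraicMonotonicity.exists_finset_piecewise
    (SemialgebraicMonotonicity.sa_graph_of_isSemialgebraicFunOn hf)
  refine ⟨s, fun x hx hxs => ?_⟩
  obtain ⟨p, q, hpx, hxq, hpq⟩ := exists_Ioo_forall_notMem_of_notMem s hxs
  have hm : x ∈ Ioo (max p a) (min q b) := ⟨max_lt hpx hx.1, lt_min hxq hx.2⟩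
  have hsub : Ioo (max p a) (min q b) ⊆ Ioo a b := fun y hy =>
    ⟨(le_max_right _ _).trans_lt hy.1, hy.2.trans_le (min_le_right _ _)⟩
  have hav : ∀ y ∈ s, y ∉ Ioo (max p a) (min q b) := fun y hy hyI =>
    hpq y hy ⟨(le_max_left _ _).trans_lt hyI.1, hyI.2.trans_le (min_le_left _ _)⟩
  have hnhds : Ioo (max p a) (min q b) ∈ 𝓝 x := Ioo_mem_nhds hm.1 hm.2
  rcases hs _ _ (hm.1.trans hm.2) hsub hav with ⟨C, hC⟩ | ⟨-, hcont⟩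
  · exact (continuousAt_const (y := C)).congr (eventuallyEq_of_mem hnhds hC).symm
  · exact hcont.continuousAt hnhds

end Graph

/-! ## Étale indices: induction on the `y`-degree -/

section Etale

open Polynomial.Bivariate

/-- A non-zero `q ∈ ℚ[x][y]` of `y`-degree `0` is a non-zero `c(x)`: off the (algebraic) real roots
of `c` it does not vanish. [folklore] -/
theorem exists_finset_ne_zero_of_natDegree_eq_zero (q : ℚ[X][Y]) (hq : q ≠ 0)
    (hdeg : q.natDegree = 0) :
    ∃ Z : Finset ℝ, (∀ e ∈ Z, IsAlgebraic ℚ e) ∧ ∀ z : Fin 2 → ℝ, z 0 ∉ Z →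
      MvPolynomial.aeval z (equivMvPolynomial ℚ q) ≠ 0 := by
  classical
  have hqC : q = C (q.coeff 0) := eq_C_of_natDegree_eq_zero hdeg
  have hc : q.coeff 0 ≠ 0 := fun h => hq (by rw [hqC, h, map_zero])
  refine ⟨((q.coeff 0).aroots ℝ).toFinset,
    fun e he => ⟨_, hc, (mem_aroots.1 (Multiset.mem_toFinset.1 he)).2⟩,
    fun z hz h0 => hz (Multiset.mem_toFinset.2 (mem_aroots.2 ⟨hc, ?_⟩))⟩
  have h1 : MvPolynomial.aeval z (equivMvPolynomial ℚ (C (q.coeff 0))) = aeval (z 0) (q.coeff 0) :=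
    by
    rw [show equivMvPolynomial ℚ (C (q.coeff 0)) = aevalAeval (MvPolynomial.X 0) (MvPolynomial.X 1)
      (C (q.coeff 0)) from rfl, aevalAeval_C, ← aeval_algHom_apply, MvPolynomial.aeval_X]
  rw [← hqC, h0] at h1
  exact h1.symm

/-- **Étale indices.** For non-zero `q ∈ ℚ[x][y]` of `y`-degree `≤ n` there is a finite set `Z` of
algebraic reals such that every real zero `(x, y)` of `q` with `x ∉ Z` is an étale zero of some
iterated `y`-derivative `∂_yʲ q`, `j ≤ n` (`∂_yʲ q (x, y) = 0`, `∂_yʲ⁺¹ q (x, y) ≠ 0`): induction on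
`n`, `Z` being the real roots of the last non-zero derivative. [cite: BochnakCosteRoy1998, §8.1] -/
theorem exists_finset_etaleIndex (n : ℕ) : ∀ q : ℚ[X][Y], q ≠ 0 → q.natDegree ≤ n →
    ∃ Z : Finset ℝ, (∀ e ∈ Z, IsAlgebraic ℚ e) ∧ ∀ z : Fin 2 → ℝ, z 0 ∉ Z →
      MvPolynomial.aeval z (equivMvPolynomial ℚ q) = 0 →
      ∃ j ≤ n, MvPolynomial.aeval z (equivMvPolynomial ℚ (derivative^[j] q)) = 0 ∧
        MvPolynomial.aeval z (equivMvPolynomial ℚ (derivative^[j + 1] q)) ≠ 0 := by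
  induction n with
  | zero =>
    intro q hq hdeg
    obtain ⟨Z, hZ, h⟩ := exists_finset_ne_zero_of_natDegree_eq_zero q hq (Nat.le_zero.1 hdeg)
    exact ⟨Z, hZ, fun z hz h0 => absurd h0 (h z hz)⟩
  | succ n ih =>
    intro q hq hdeg
    by_cases hd : derivative q = 0
    · obtain ⟨Z, hZ, h⟩ := exists_finset_ne_zero_of_natDegree_eq_zero q hq (derivative_eq_zero.1 hd)
      exact ⟨Z, hZ, fun z hz h0 => absurd h0 (h z hz)⟩
    · obtain ⟨Z, hZ, h⟩ := ih (derivative q) hd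
        ((natDegree_derivative_le q).trans (by omega))
      refine ⟨Z, hZ, fun z hz h0 => ?_⟩
      by_cases h1 : MvPolynomial.aeval z (equivMvPolynomial ℚ (derivative q)) = 0
      · obtain ⟨j, hj, hj0, hj1⟩ := h z hz h1
        exact ⟨j + 1, by omega, by simpa only [Function.iterate_succ_apply] using hj0,
          by simpa only [Function.iterate_succ_apply] using hj1⟩
      · exact ⟨0, Nat.zero_le _, h0, h1⟩

/-- The `y`-derivative of `(x, t) ↦ p(x, t)` is `∂₁ p`. [folklore] -/
theorem hasDerivAt_aeval_snd (p : MvPolynomial (Fin 2) ℚ) (x t : ℝ) :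
    HasDerivAt (fun s : ℝ => MvPolynomial.aeval ![x, s] p)
      (MvPolynomial.aeval ![x, t] (MvPolynomial.pderiv 1 p)) t := by
  induction p using MvPolynomial.induction_on with
  | C a =>
    simp only [MvPolynomial.aeval_C, MvPolynomial.pderiv_C, map_zero]
    exact hasDerivAt_const t _
  | add p q hp hq =>
    simp only [map_add]
    exact hp.add hq
  | mul_X p i hp =>
    fin_cases i
    · simp only [Fin.zero_eta, map_mul, MvPolynomial.aeval_X, Matrix.cons_val_zero]
      refine (hp.mul_const x).congr_deriv ?_
      rw [mul_comm]
      simp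
    · simp only [Fin.mk_one, map_mul, MvPolynomial.aeval_X, Matrix.cons_val_one]
      refine (hp.mul (hasDerivAt_id' t)).congr_deriv ?_
      rw [mul_one, add_comm, mul_comm]
      simp

/-- **Analyticity of a continuous étale root branch** (real-analytic implicit function theorem,
Mathlib `ContDiffAt.implicitFunction` at `n = ω`, plus continuity to identify the branch).
[cite: BochnakCosteRoy1998, Prop. 8.1.8 (Nash functions)] -/
theorem analyticAt_of_etale {f : ℝ → ℝ} {x₀ : ℝ} (p : MvPolynomial (Fin 2) ℚ)
    (hc : ContinuousAt f x₀)
    (h0 : ∀ᶠ x in 𝓝 x₀, MvPolynomial.aeval ![x, f x] p = 0)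
    (h1 : MvPolynomial.aeval ![x₀, f x₀] (MvPolynomial.pderiv 1 p) ≠ 0) : AnalyticAt ℝ f x₀ := by
  set F : ℝ × ℝ → ℝ := fun u => MvPolynomial.aeval ![u.1, u.2] p
  have han : ∀ u, AnalyticAt ℝ F u := fun u =>
    AnalyticAt.aeval_mvPolynomial (fun i => by
      fin_cases i
      · simpa using analyticAt_fst
      · simpa using analyticAt_snd) p
  have cdf : ContDiffAt ℝ ω F (x₀, f x₀) := (han _).contDiffAt
  have hdF : fderiv ℝ F (x₀, f x₀) ∘L ContinuousLinearMap.inr ℝ ℝ ℝ =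
      (1 : ℝ →L[ℝ] ℝ).smulRight (MvPolynomial.aeval ![x₀, f x₀] (MvPolynomial.pderiv 1 p)) := by
    have e1 : HasFDerivAt (fun t : ℝ => F (x₀, t))
        (fderiv ℝ F (x₀, f x₀) ∘L ContinuousLinearMap.inr ℝ ℝ ℝ) (f x₀) :=
      (han _).differentiableAt.hasFDerivAt.comp (f x₀) (hasFDerivAt_prodMk_right x₀ (f x₀))
    exact e1.unique (hasDerivAt_aeval_snd p x₀ (f x₀)).hasFDerivAt
  have if₂ : (fderiv ℝ F (x₀, f x₀) ∘L ContinuousLinearMap.inr ℝ ℝ ℝ).IsInvertible := by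
    rw [hdF]
    refine ⟨ContinuousLinearEquiv.unitsEquivAut ℝ (Units.mk0 _ h1), ?_⟩
    ext
    simp [ContinuousLinearEquiv.unitsEquivAut_apply]
  have hω : (ω : ℕ∞ω) ≠ 0 := by simp
  have hψ : AnalyticAt ℝ (cdf.implicitFunction hω if₂) x₀ :=
    (cdf.contDiffAt_implicitFunction hω if₂).analyticAt
  have htend : Tendsto (fun x => (x, f x)) (𝓝 x₀) (𝓝 (x₀, f x₀)) := continuousAt_id.prodMk hc
  refine hψ.congr ?_
  filter_upwards [htend.eventually (cdf.eventually_apply_eq_iff_implicitFunction hω if₂), h0]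
    with x hx hx0
  refine hx.1 ?_
  change MvPolynomial.aeval ![x, f x] p = MvPolynomial.aeval ![x₀, f x₀] p
  rw [hx0, show MvPolynomial.aeval ![x₀, f x₀] p = 0 from h0.self_of_nhds]

/-- **Algebraic values at algebraic points**: an étale zero `(x, y)` of `p ∈ ℚ[x, y]` with `x`
algebraic has `y` algebraic — `y` is a root of the non-zero polynomial `p(x, ·) ∈ ℚ⟮x⟯[Y]`, and
`ℚ⟮x⟯/ℚ` is algebraic. [folklore] -/
theorem isAlgebraic_of_etale (p : MvPolynomial (Fin 2) ℚ) {x y : ℝ} (hx : IsAlgebraic ℚ x)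
    (h0 : MvPolynomial.aeval ![x, y] p = 0)
    (h1 : MvPolynomial.aeval ![x, y] (MvPolynomial.pderiv 1 p) ≠ 0) : IsAlgebraic ℚ y := by
  haveI := IntermediateField.adjoin.finiteDimensional hx.isIntegral
  set x' : ℚ⟮x⟯ := ⟨x, IntermediateField.mem_adjoin_simple_self ℚ x⟩ with hx'
  set r : ℚ⟮x⟯[X] := MvPolynomial.aeval ![Polynomial.C x', Polynomial.X] p with hr
  have hev : ∀ t : ℝ, aeval t r = MvPolynomial.aeval ![x, t] p := fun t => by
    rw [hr, ← AlgHom.restrictScalars_apply ℚ (aeval t), ← AlgHom.comp_apply,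
      MvPolynomial.comp_aeval]
    congr 1
    ext i; fin_cases i
    · simp [hx']
    · simp
  refine IsAlgebraic.restrictScalars ℚ (S := ℚ⟮x⟯) (A := ℝ) ⟨r, fun hr0 => h1 ?_, by rw [hev, h0]⟩
  exact (hasDerivAt_aeval_snd p x y).unique ((hasDerivAt_const y (0 : ℝ)).congr_of_eventuallyEq
    (Eventually.of_forall fun s =>
      (by rw [← hev, hr0, map_zero] : MvPolynomial.aeval ![x, s] p = 0)))

end Etale

/-! ## The stub -/

/-- STUB `stub_saPieceFacts` of line `standard-etale-models`: STRUCTURE OF ONE-VARIABLE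
`ℚ`-SEMIALGEBRAIC DATA. (1) A `ℚ`-semialgebraic subset of `ℝ¹` has finitely many (algebraic)
boundary points: membership is constant on every interval avoiding them. (2) A function with
`ℚ`-semialgebraic graph over a bounded `(a, b)` has a finite set `B` of ALGEBRAIC break points off
which, on each complementary cell `(u, v)`, it is real-analytic and an ÉTALE branch of ONE plane
curve with rational coefficients (`P(x, f x) = 0`, `∂_y P(x, f x) ≠ 0`), taking algebraic values at
algebraic points (Zariski closure of the graph, induction on `deg_y`, Tarski–Seidenberg for the
étale-index and continuity sets, monotonicity for the finiteness of discontinuities, analytic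
implicit function theorem, `ℚ⟮x⟯` algebraic). [cite: BochnakCosteRoy1998, Prop. 2.9.10 and §8.1] -/
theorem stub_saPieceFacts :
    (∀ σ : Set (Fin 1 → ℝ), IsSemialgebraic ℚ σ → ∃ E : Finset ℝ, (∀ e ∈ E, IsAlgebraic ℚ e) ∧
      ∀ x y : ℝ, x < y → (∀ e ∈ E, e ∉ Set.Icc x y) → ((fun _ => x) ∈ σ ↔ (fun _ => y) ∈ σ)) ∧
    (∀ (f : ℝ → ℝ) (a b : ℝ), a < b →
      IsSemialgebraicFunOn ℚ {z : Fin 1 → ℝ | z 0 ∈ Set.Ioo a b} (fun z => f (z 0)) →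
      ∃ B : Finset ℝ, (↑B : Set ℝ) ⊆ Set.Ioo a b ∧ (∀ x ∈ B, IsAlgebraic ℚ x) ∧
        ∀ u v : ℝ, u < v → (u = a ∨ u ∈ B) → (v = b ∨ v ∈ B) → (∀ x ∈ B, x ∉ Set.Ioo u v) →
          ∃ P : MvPolynomial (Fin 2) ℝ, (∀ d, IsAlgebraic ℚ (P.coeff d)) ∧
            ∀ x ∈ Set.Ioo u v, AnalyticAt ℝ f x ∧ MvPolynomial.eval ![x, f x] P = 0 ∧
              MvPolynomial.eval ![x, f x] (MvPolynomial.pderiv 1 P) ≠ 0 ∧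
              (IsAlgebraic ℚ x → IsAlgebraic ℚ (f x))) := by
  classical
  refine ⟨exists_finset_mem_iff_mem, fun f a b _ hf => ?_⟩
  have hG : IsSemialgebraic ℚ {w : Fin 2 → ℝ | w 0 ∈ Ioo a b ∧ w 1 = f (w 0)} :=
    isSemialgebraicFunOn_iff.mp hf
  -- the algebraic relation of the graph and its étale indices
  obtain ⟨P₀, ⟨z₀, hz₀⟩, hP₀⟩ := hG.exists_forall_aeval_eq_zero_of_interior_eq_empty
    (interior_setOf_graph_eq_empty Fin.zero_ne_one (Ioo a b) f)
  set q₀ : ℚ[X][Y] := (Bivariate.equivMvPolynomial ℚ).symm P₀ with hq₀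
  have hq₀P : Bivariate.equivMvPolynomial ℚ q₀ = P₀ :=
    (Bivariate.equivMvPolynomial ℚ).apply_symm_apply P₀
  have hq₀0 : q₀ ≠ 0 := fun h => hz₀ (by rw [← hq₀P, h, map_zero, map_zero])
  obtain ⟨Z, hZalg, hZ⟩ := exists_finset_etaleIndex q₀.natDegree q₀ hq₀0 le_rfl
  -- the étale-index sets `S j` and their finitely many algebraic boundary points
  set S : ℕ → Set ℝ := fun j => {x | x ∈ Ioo a b ∧
    MvPolynomial.aeval ![x, f x] (Bivariate.equivMvPolynomial ℚ (derivative^[j] q₀)) = 0 ∧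
    MvPolynomial.aeval ![x, f x] (Bivariate.equivMvPolynomial ℚ (derivative^[j + 1] q₀)) ≠ 0}
  have hSE : ∀ j, ∃ E : Finset ℝ, (∀ e ∈ E, IsAlgebraic ℚ e) ∧
      ∀ x y : ℝ, x < y → (∀ e ∈ E, e ∉ Icc x y) → (x ∈ S j ↔ y ∈ S j) := fun j =>
    exists_finset_mem_iff_mem {z : Fin 1 → ℝ | z 0 ∈ S j} (sa_etaleSet hG _ _)
  choose E hEalg hE using hSE
  -- continuity: finitely many discontinuities, `ℚ`-definable continuity set
  obtain ⟨sD, hsD⟩ := exists_finset_continuousAt hf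
  obtain ⟨EC, hECalg, hEC⟩ := exists_finset_mem_iff_mem
    {z : Fin 1 → ℝ | z 0 ∈ Ioo a b ∧ ContinuousAt f (z 0)} (sa_continuousAt hG)
  -- the break points
  set B₀ : Finset ℝ := Z ∪ (Finset.range (q₀.natDegree + 1)).biUnion E ∪ EC
  refine ⟨B₀.filter (fun x => x ∈ Ioo a b),
    fun x hx => (Finset.mem_filter.1 (Finset.mem_coe.1 hx)).2, fun x hx => ?_,
    fun u v huv hu hv hav => ?_⟩
  · rcases Finset.mem_union.1 (Finset.mem_filter.1 hx).1 with hx' | hxC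
    · rcases Finset.mem_union.1 hx' with hxZ | hxE
      · exact hZalg x hxZ
      · obtain ⟨j, -, hj⟩ := Finset.mem_biUnion.1 hxE
        exact hEalg j x hj
    · exact hECalg x hxC
  -- a cell `(u, v)`
  have hBab : ∀ x ∈ B₀.filter (fun x => x ∈ Ioo a b), x ∈ Ioo a b := fun x hx =>
    (Finset.mem_filter.1 hx).2
  have hsub : Ioo u v ⊆ Ioo a b := fun x hx =>
    ⟨(hu.elim (fun h => h.symm.le) fun h => (hBab u h).1.le).trans_lt hx.1,
      hx.2.trans_le (hv.elim (fun h => h.le) fun h => (hBab v h).2.le)⟩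
  have havoid : ∀ e ∈ B₀, e ∈ Ioo a b → e ∉ Ioo u v := fun e he heab =>
    hav e (Finset.mem_filter.2 ⟨he, heab⟩)
  obtain ⟨x₁, hx₁, hx₁D⟩ : (Ioo u v \ (sD : Set ℝ)).Nonempty :=
    ((Ioo_infinite huv).sdiff sD.finite_toSet).nonempty
  have hx₁ab : x₁ ∈ Ioo a b := hsub hx₁
  have hcont : ∀ x ∈ Ioo u v, ContinuousAt f x := fun x hx =>
    (mem_of_mem_of_cell (A := {x | x ∈ Ioo a b ∧ ContinuousAt f x}) hEC hsub
      (fun e he => havoid e (Finset.mem_union_right _ he)) hx₁ hx ⟨hx₁ab, hsD x₁ hx₁ab hx₁D⟩).2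
  have hx₁Z : x₁ ∉ Z := fun h =>
    havoid x₁ (Finset.mem_union_left _ (Finset.mem_union_left _ h)) hx₁ab hx₁
  obtain ⟨j, hjN, hj0, hj1⟩ := hZ ![x₁, f x₁] (by simpa using hx₁Z)
    (by rw [hq₀P]; exact hP₀ _ ⟨by simpa using hx₁ab, by simp⟩)
  have hcell : ∀ x ∈ Ioo u v, x ∈ S j := fun x hx =>
    mem_of_mem_of_cell (hE j) hsub (fun e he => havoid e (Finset.mem_union_left _
      (Finset.mem_union_right _ (Finset.mem_biUnion.2 ⟨j, Finset.mem_range.2 (by omega), he⟩))))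
      hx₁ hx ⟨hx₁ab, hj0, hj1⟩
  have hev : ∀ (r : MvPolynomial (Fin 2) ℚ) (w : Fin 2 → ℝ),
      MvPolynomial.eval w (MvPolynomial.map (algebraMap ℚ ℝ) r) = MvPolynomial.aeval w r :=
    fun r w => by rw [MvPolynomial.eval_map, MvPolynomial.aeval_def]
  have hsucc : MvPolynomial.pderiv 1 (Bivariate.equivMvPolynomial ℚ (derivative^[j] q₀)) =
      Bivariate.equivMvPolynomial ℚ (derivative^[j + 1] q₀) := by
    rw [Bivariate.pderiv_one_equivMvPolynomial, Function.iterate_succ_apply']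
  refine ⟨MvPolynomial.map (algebraMap ℚ ℝ) (Bivariate.equivMvPolynomial ℚ (derivative^[j] q₀)),
    fun d => by rw [MvPolynomial.coeff_map]; exact isAlgebraic_algebraMap _, fun x hx => ?_⟩
  obtain ⟨-, hx0, hx1⟩ := hcell x hx
  rw [← hsucc] at hx1
  refine ⟨analyticAt_of_etale _ (hcont x hx) ?_ hx1, by rw [hev]; exact hx0,
    by rw [MvPolynomial.pderiv_map, hev]; exact hx1,
    fun hxalg => isAlgebraic_of_etale _ hxalg hx0 hx1⟩
  filter_upwards [Ioo_mem_nhds hx.1 hx.2] with x' hx' using (hcell x' hx').2.1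

end Summit.KontsevichZagierPeriods.SymplecticScissors.CurvePeriodsTransfer

end
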